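import Summits.MatrixMultiplication.MatrixMultiplication.Theses.IntegralSignedBoxes

/-!
# Birth skeleton (BC3) for the crux `PadicLifting` — "ω(ℤ_(p)) ≤ ω(𝔽_p) for every prime p"

Line `hensel-artin` (the route's own foreseen two-layer plan for the local question):
* `stub_henselToPadicIntegers` — HENSEL at the exponent level: `ω(ℤ_p) ≤ ω(𝔽_p)` over the
  COMPLETE p-adic integers `PadicInt p`: a mod-p exponent bound lifts to schemes with p-adic
  integer coefficients (deformation of the Brent scheme out of its special fibre; the obstruction
  classes of the individual rank-47 𝔽₂-schemes for ⟨4,4,4⟩ must be beaten at the exponent level,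
  e.g. after Kronecker powers / format growth).
* `stub_padicIntegersToLocal` — ARTIN + WEIL: `ω(ℤ_(p)) ≤ ω(ℤ_p)`: a scheme over `ℤ_p` is
  approximated by one over the henselisation (Artin approximation for the Brent equations), i.e.
  over p-integral algebraic numbers in a number field `K ⊂ ℚ_p`, and restriction of scalars along a
  `ℤ_(p)`-basis of `(O_K)_(p)` gives a rational scheme with denominators prime to `p` at a rank cost
  `≤ [K:ℚ]^2`, absorbed by Kronecker powers — plausibly PROVABLE (difficulty L).
`PadicLifting_of` composes them.  Sorries live ONLY in the two stubs.
-/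

set_option linter.dupNamespace false

namespace Summit.MatrixMultiplication.MatrixMultiplication.Cruxes.PadicLifting.HenselArtin

open Literature.Computability.AlgebraicComplexity

/-! The crux is the route decl `Summit.MatrixMultiplication.MatrixMultiplication.Theses.IntegralSignedBoxes.PadicLifting`
(route rev 2), used BY NAME. -/
open Summit.MatrixMultiplication.MatrixMultiplication.Theses.IntegralSignedBoxes (PadicLifting)

/-- STUB — Hensel at the exponent level: `ω(ℤ_p) ≤ ω(𝔽_p)` (complete p-adic integers). -/
theorem stub_henselToPadicIntegers :
    ∀ (p : ℕ) [Fact p.Prime] (τ : ℝ),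
      (∀ ε : ℝ, 0 < ε → ∃ n : ℕ, 2 ≤ n ∧
        (tensorRank (matMulTensor (ZMod p) n n n) : ℝ) ≤ (n : ℝ) ^ (τ + ε)) →
      ∀ ε : ℝ, 0 < ε → ∃ n : ℕ, 2 ≤ n ∧
        (tensorRank (matMulTensor (PadicInt p) n n n) : ℝ) ≤ (n : ℝ) ^ (τ + ε) := by
  sorry

/-- STUB — Artin approximation + restriction of scalars: `ω(ℤ_(p)) ≤ ω(ℤ_p)` (a p-adically
integral scheme yields rational schemes with denominators prime to `p`). -/
theorem stub_padicIntegersToLocal :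
    ∀ (p : ℕ) [Fact p.Prime] (τ : ℝ),
      (∀ ε : ℝ, 0 < ε → ∃ n : ℕ, 2 ≤ n ∧
        (tensorRank (matMulTensor (PadicInt p) n n n) : ℝ) ≤ (n : ℝ) ^ (τ + ε)) →
      ∀ ε : ℝ, 0 < ε → ∃ n : ℕ, 2 ≤ n ∧ ∃ D : ℕ, ¬ p ∣ D ∧
        (tensorRank ((D : ℤ) • matMulTensor ℤ n n n) : ℝ) ≤ (n : ℝ) ^ (τ + ε) := by
  sorry

/-- Composition: Hensel to `ℤ_p`, then Artin/Weil down to `ℤ_(p)` ⇒ `PadicLifting`. -/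
theorem PadicLifting_of :
    (∀ (p : ℕ) [Fact p.Prime] (τ : ℝ),
      (∀ ε : ℝ, 0 < ε → ∃ n : ℕ, 2 ≤ n ∧
        (tensorRank (matMulTensor (ZMod p) n n n) : ℝ) ≤ (n : ℝ) ^ (τ + ε)) →
      ∀ ε : ℝ, 0 < ε → ∃ n : ℕ, 2 ≤ n ∧
        (tensorRank (matMulTensor (PadicInt p) n n n) : ℝ) ≤ (n : ℝ) ^ (τ + ε)) →
    (∀ (p : ℕ) [Fact p.Prime] (τ : ℝ),
      (∀ ε : ℝ, 0 < ε → ∃ n : ℕ, 2 ≤ n ∧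
        (tensorRank (matMulTensor (PadicInt p) n n n) : ℝ) ≤ (n : ℝ) ^ (τ + ε)) →
      ∀ ε : ℝ, 0 < ε → ∃ n : ℕ, 2 ≤ n ∧ ∃ D : ℕ, ¬ p ∣ D ∧
        (tensorRank ((D : ℤ) • matMulTensor ℤ n n n) : ℝ) ≤ (n : ℝ) ^ (τ + ε)) →
    PadicLifting := by
  intro hH hA p hp τ hyp
  haveI : Fact p.Prime := ⟨hp⟩
  exact hA p τ (hH p τ hyp)

/-- The skeleton concludes the crux from the two stubs. -/
theorem PadicLifting_of_stubs : PadicLifting :=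
  PadicLifting_of (fun p _ τ => stub_henselToPadicIntegers p τ)
    (fun p _ τ => stub_padicIntegersToLocal p τ)

end Summit.MatrixMultiplication.MatrixMultiplication.Cruxes.PadicLifting.HenselArtin
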